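/-
Copyright: rh-split cell, seat prover-l1 (L1/L19 «DUST WALL»), 2026-08-27.  Plane topology.
Nothing here bears on the truth of RH.
-/
import Summits.RiemannHypothesis.RiemannHypothesis.Theorems.Splittings.ScrewBorelFluxB
import Mathlib.Topology.Separation.Profinite
import HarnessLib

/-!
# A point-component of a plane compactum has small clopen pieces with a moat (Šura-Bura / Zoretti step)

Plane-topology piece for the crux `PointComponentInvisible` (route `ScrewDustWall`, X-11 «DUST WALL»,
stmt-RiemannHypothesis-21690).  Let `W ⊆ ℂ` be closed, `p ∈ W` with `‖p‖ < 1`, and suppose the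
connected component of `p` in `W ∩ 𝔻` is `{p}` (a POINT-COMPONENT of the wall).  Then for every
small `ε > 0` there are (`exists_clopen_piece`)

* a compact PIECE `P ⊆ W` with `p ∈ P ⊆ ball p (ε/4)` and `W ∖ P` closed (so `P` is clopen in `W`),
* a MOAT of width `ρ > 0`: `dist (P, W ∖ P) ≥ ρ`,
* an open preconnected NEIGHBOURHOOD `N` of `P` with `p ∈ N ⊆ ball p ε`, `N ∩ W ⊆ P` and
  `ball w ρ ⊆ N` for every `w ∈ P`.

Proof.  In the compact space `K = W ∩ closedBall p ε` the component of `p` is `{p}`; components of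
compact Hausdorff spaces are intersections of clopen sets (`connectedComponent_eq_iInter_isClopen`,
Šura-Bura), so by compactness some clopen `Z ∋ p` of `K` lies in `ball p (ε/4)`; it is compact,
relatively open in `W`, hence at positive distance `η₀` from `W ∖ Z` (`ScrewBorelFlux.exists_separation`).
With `ρ = min (η₀/2) (ε/4)` let `N` be the component of `p` in the open `ρ`-neighbourhood `G` of `Z`
and `P = Z ∩ N`: balls `ball w ρ` (`w ∈ P`) are connected subsets of `G` through `N`, which gives the
last property, the closedness of `P` and of `W ∖ P`, and the moat.

No `sorry`, no new axioms, no definitions, no instances, no notation.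
-/

set_option linter.dupNamespace false

namespace Summit.RiemannHypothesis.RiemannHypothesis.Theorems.Splittings.ScrewDust

open Complex Filter Topology Set Metric
open Summit.RiemannHypothesis.RiemannHypothesis.Theorems.Splittings.ScrewBorelFlux

/-- **Šura-Bura step.**  In a closed plane set `W`, a point `p` of the unit disc whose component in
`W ∩ 𝔻` is `{p}` has, inside every small ball, a compact piece `Z ∋ p` of `W` with `W ∖ Z` closed. -/
theorem exists_small_clopen {W : Set ℂ} (hW : IsClosed W) {p : ℂ} (hpW : p ∈ W)
    (hcomp : connectedComponentIn (W ∩ ball (0 : ℂ) 1) p ⊆ {p}) {ε : ℝ} (hε : 0 < ε)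
    (hε1 : ε < 1 - ‖p‖) {r : ℝ} (hr : 0 < r) (hrε : r ≤ ε) :
    ∃ Z : Set ℂ, IsCompact Z ∧ Z ⊆ W ∧ p ∈ Z ∧ Z ⊆ ball p r ∧ IsClosed (W \ Z) := by
  classical
  set K : Set ℂ := W ∩ closedBall p ε with hKdef
  have hKc : IsCompact K := (isCompact_closedBall p ε).inter_left hW
  have hK1 : K ⊆ W ∩ ball (0 : ℂ) 1 := fun z hz ↦ ⟨hz.1, by
    have h := mem_closedBall.1 hz.2
    rw [mem_ball_zero_iff]
    calc ‖z‖ = ‖p + (z - p)‖ := by congr 1; ring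
      _ ≤ ‖p‖ + ‖z - p‖ := norm_add_le _ _
      _ = ‖p‖ + dist z p := by rw [dist_eq_norm]
      _ < 1 := by linarith⟩
  haveI : CompactSpace K := isCompact_iff_compactSpace.1 hKc
  set x₀ : K := ⟨p, hpW, mem_closedBall_self hε.le⟩ with hx₀
  -- the component of `x₀` in `K` is `{x₀}`
  have hcc : connectedComponent x₀ = {x₀} := by
    refine Subset.antisymm (fun y hy ↦ ?_) (singleton_subset_iff.2 mem_connectedComponent)
    have h1 : IsPreconnected (((↑) : K → ℂ) '' connectedComponent x₀) :=
      isPreconnected_connectedComponent.image _ continuous_subtype_val.continuousOn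
    have h2 : ((↑) : K → ℂ) '' connectedComponent x₀ ⊆ W ∩ ball (0 : ℂ) 1 := by
      rintro _ ⟨z, _, rfl⟩; exact hK1 z.2
    have h3 : p ∈ ((↑) : K → ℂ) '' connectedComponent x₀ := ⟨x₀, mem_connectedComponent, rfl⟩
    have h4 := hcomp (h1.subset_connectedComponentIn h3 h2 ⟨y, hy, rfl⟩)
    rw [mem_singleton_iff] at h4 ⊢
    exact Subtype.ext h4
  -- Šura-Bura: a clopen piece of `K` containing `x₀` inside the small ball
  set U : Set K := {y : K | dist (y : ℂ) p < r} with hU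
  have hUo : IsOpen U := isOpen_lt (by fun_prop) continuous_const
  have hx₀U : x₀ ∈ U := by simp [hU, hx₀, hr]
  let ι' := {s : Set K // IsClopen s ∧ x₀ ∈ s}
  haveI : Nonempty ι' := ⟨⟨univ, isClopen_univ, mem_univ _⟩⟩
  have hdir : Directed (· ⊇ ·) fun s : ι' ↦ s.val := by
    rintro ⟨s, hs, hxs⟩ ⟨t, ht, hxt⟩
    exact ⟨⟨s ∩ t, hs.inter ht, ⟨hxs, hxt⟩⟩, inter_subset_left, inter_subset_right⟩
  have hnhds : ∀ y ∈ ⋂ s : ι', s.val, U ∈ 𝓝 y := by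
    intro y hy
    rw [← connectedComponent_eq_iInter_isClopen, hcc, mem_singleton_iff] at hy
    rw [hy]
    exact hUo.mem_nhds hx₀U
  obtain ⟨⟨Z, hZc, hZx⟩, hZU⟩ := exists_subset_nhds_of_compactSpace hdir (fun s ↦ s.2.1.1) hnhds
  -- push down to `ℂ`
  obtain ⟨O, hO, hOZ⟩ := isOpen_induced_iff.1 hZc.2
  refine ⟨((↑) : K → ℂ) '' Z, hZc.1.isCompact.image continuous_subtype_val, ?_, ⟨x₀, hZx, rfl⟩, ?_, ?_⟩
  · rintro _ ⟨z, _, rfl⟩; exact z.2.1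
  · rintro _ ⟨z, hz, rfl⟩
    exact mem_ball.2 (hZU hz)
  · have e : W \ ((↑) : K → ℂ) '' Z = W ∩ (O ∩ ball p ε)ᶜ := by
      ext z
      constructor
      · rintro ⟨hzW, hzZ⟩
        refine ⟨hzW, fun ⟨hzO, hzε⟩ ↦ hzZ ?_⟩
        have hzK : z ∈ K := ⟨hzW, ball_subset_closedBall hzε⟩
        refine ⟨⟨z, hzK⟩, ?_, rfl⟩
        rw [← hOZ]; exact hzO
      · rintro ⟨hzW, hz⟩
        refine ⟨hzW, ?_⟩
        rintro ⟨y, hy, rfl⟩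
        refine hz ⟨?_, ?_⟩
        · have : y ∈ ((↑) : K → ℂ) ⁻¹' O := by rw [hOZ]; exact hy
          exact this
        · have := hZU hy
          simp only [hU, mem_setOf_eq] at this
          exact mem_ball.2 (this.trans_le hrε)
    rw [e]
    exact hW.inter (hO.inter isOpen_ball).isClosed_compl

/-- **Clopen piece with a moat and a connected neighbourhood.**  See the module docstring. -/
theorem exists_clopen_piece {W : Set ℂ} (hW : IsClosed W) {p : ℂ} (hpW : p ∈ W)
    (hcomp : connectedComponentIn (W ∩ ball (0 : ℂ) 1) p ⊆ {p}) {ε : ℝ} (hε : 0 < ε)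
    (hε1 : ε < 1 - ‖p‖) :
    ∃ (P N : Set ℂ) (ρ : ℝ), 0 < ρ ∧ ρ ≤ ε / 4 ∧ IsCompact P ∧ P ⊆ W ∧ p ∈ P ∧ P ⊆ ball p (ε / 4) ∧
      IsClosed (W \ P) ∧ (∀ w ∈ P, ∀ z ∈ W \ P, ρ ≤ dist w z) ∧
      IsOpen N ∧ IsPreconnected N ∧ p ∈ N ∧ N ⊆ ball p ε ∧ N ∩ W ⊆ P ∧ (∀ w ∈ P, ball w ρ ⊆ N) := by
  obtain ⟨Z, hZc, hZW, hpZ, hZr, hWZ⟩ :=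
    exists_small_clopen hW hpW hcomp hε hε1 (by linarith : 0 < ε / 4) (by linarith)
  have hZne : Z.Nonempty := ⟨p, hpZ⟩
  -- the gap between `Z` and the rest of the wall
  obtain ⟨η₀, hη₀, hsep⟩ : ∃ η₀ > 0, ∀ z ∈ Z, ∀ q ∈ W \ Z, η₀ ≤ ‖q - z‖ :=
    exists_separation hZc (by rw [hWZ.closure_eq]; exact disjoint_sdiff_right)
  set ρ : ℝ := min (η₀ / 2) (ε / 4) with hρdef
  have hρ0 : 0 < ρ := lt_min (by linarith) (by linarith)
  have hρη : ρ < η₀ := (min_le_left _ _).trans_lt (by linarith)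
  have hρε : ρ ≤ ε / 4 := min_le_right _ _
  -- the `ρ`-neighbourhood of `Z` and its component through `p`
  set G : Set ℂ := {z : ℂ | infDist z Z < ρ} with hGdef
  have hGo : IsOpen G := isOpen_lt (continuous_infDist_pt Z) continuous_const
  have hpG : p ∈ G := by
    rw [hGdef, mem_setOf_eq, infDist_zero_of_mem hpZ]; exact hρ0
  set N : Set ℂ := connectedComponentIn G p with hNdef
  have hNo : IsOpen N := hGo.connectedComponentIn
  have hNG : N ⊆ G := connectedComponentIn_subset _ _
  have hball : ∀ w ∈ Z, w ∈ N → ball w ρ ⊆ N := by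
    intro w hwZ hwN
    have hsub : ball w ρ ⊆ G := fun z hz ↦ by
      rw [hGdef, mem_setOf_eq]
      exact (infDist_le_dist_of_mem hwZ).trans_lt (mem_ball.1 hz)
    rw [hNdef, connectedComponentIn_eq hwN]
    exact (convex_ball w ρ).isPreconnected.subset_connectedComponentIn (mem_ball_self hρ0) hsub
  -- points of `G ∩ W` are in `Z`
  have hGW : ∀ z ∈ G, z ∈ W → z ∈ Z := by
    intro z hzG hzW
    by_contra hzZ
    have h1 : η₀ ≤ infDist z Z := (le_infDist hZne).2 fun w hw ↦ by
      rw [dist_eq_norm]; exact hsep w hw z ⟨hzW, hzZ⟩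
    have h2 : infDist z Z < ρ := hzG
    linarith
  set P : Set ℂ := Z ∩ N with hPdef
  -- `P` is closed
  have hPcl : IsClosed P := by
    refine isClosed_of_closure_subset fun z hz ↦ ?_
    have hzZ : z ∈ Z := closure_minimal inter_subset_left hZc.isClosed hz
    have hzG : z ∈ G := by
      rw [hGdef, mem_setOf_eq, infDist_zero_of_mem hzZ]; exact hρ0
    have hzNz : z ∈ connectedComponentIn G z := mem_connectedComponentIn hzG
    obtain ⟨w, hwNz, hwP⟩ := mem_closure_iff.1 hz _ hGo.connectedComponentIn hzNz
    have : connectedComponentIn G p = connectedComponentIn G z := by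
      rw [connectedComponentIn_eq hwP.2, connectedComponentIn_eq hwNz]
    exact ⟨hzZ, by rw [hNdef, this]; exact hzNz⟩
  refine ⟨P, N, ρ, hρ0, hρε, hZc.of_isClosed_subset hPcl inter_subset_left,
    inter_subset_left.trans hZW, ⟨hpZ, mem_connectedComponentIn hpG⟩,
    inter_subset_left.trans hZr, ?_, ?_, hNo, isPreconnected_connectedComponentIn,
    mem_connectedComponentIn hpG, ?_, ?_, fun w hw ↦ hball w hw.1 hw.2⟩
  · -- `W \ P` is closed
    have e : W \ P = (W \ Z) ∪ (Z ∩ Nᶜ) := by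
      ext z
      simp only [hPdef, Set.mem_sdiff, mem_inter_iff, mem_union, mem_compl_iff]
      constructor
      · rintro ⟨hzW, hzP⟩
        by_cases hzZ : z ∈ Z
        · exact Or.inr ⟨hzZ, fun hzN ↦ hzP ⟨hzZ, hzN⟩⟩
        · exact Or.inl ⟨hzW, hzZ⟩
      · rintro (⟨hzW, hzZ⟩ | ⟨hzZ, hzN⟩)
        · exact ⟨hzW, fun h ↦ hzZ h.1⟩
        · exact ⟨hZW hzZ, fun h ↦ hzN h.2⟩
    rw [e]
    exact hWZ.union (hZc.isClosed.inter hNo.isClosed_compl)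
  · -- the moat
    intro w hw z hz
    by_cases hzZ : z ∈ Z
    · by_contra hlt
      push Not at hlt
      have hzN : z ∈ N := hball w hw.1 hw.2 (by rw [mem_ball, dist_comm]; exact hlt)
      exact hz.2 ⟨hzZ, hzN⟩
    · have := hsep w hw.1 z ⟨hz.1, hzZ⟩
      rw [← dist_eq_norm, dist_comm] at this
      linarith [min_le_left (η₀ / 2) (ε / 4)]
  · -- `N ⊆ ball p ε`
    intro z hzN
    have hzG : infDist z Z < ρ := hNG hzN
    obtain ⟨w, hwZ, hzw⟩ := (infDist_lt_iff hZne).1 hzG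
    have hwp : dist w p < ε / 4 := mem_ball.1 (hZr hwZ)
    rw [mem_ball]
    calc dist z p ≤ dist z w + dist w p := dist_triangle _ _ _
      _ < ρ + ε / 4 := add_lt_add hzw hwp
      _ ≤ ε / 4 + ε / 4 := by linarith
      _ < ε := by linarith
  · -- `N ∩ W ⊆ P`
    rintro z ⟨hzN, hzW⟩
    exact ⟨hGW z (hNG hzN) hzW, hzN⟩

end Summit.RiemannHypothesis.RiemannHypothesis.Theorems.Splittings.ScrewDust
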